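import Summits.QuantumAdvantage.QuantumAdvantage.Theses.CompactnessLift
import Literature.Computability.Complexity.PaulPippengerSzemerediTrotter1983Blocks
import Literature.Computability.Complexity.RelativizedTime

/-!
# Crux `CompactnessPrinciple` (stmt-QuantumAdvantage-15270): the slice `c = 0` of the typed class family is EMPTY

Standing disprover (refuter-cdisprove-stmt-QuantumAdvantage-15270-0, 2026-08-17), tightness / small-model
section of `Cruxes/CompactnessPrinciple/Disproof.lean`, landed.

The crux as typed concludes `∃ c, QuadQ ⊆ bp (DTIME (fun n => n ^ c))`. The refuters' standing finding
(`Disproof.lean`, `compactnessPrinciple_of_H1`; rreview-0816, rattack-15270-0) is that every slice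
`c ≥ 1` is all of `BPP` (coin padding, modulo `H1 : BPP ⊆ ⋃ k, BPTime (· ^ k)`). This file settles the
remaining slice: **`bp (DTIME (fun n => n ^ 0)) = ∅`** (`bp_DTIME_pow_zero_eq_empty`), unconditionally.
So the typed family `c ↦ bp (DTIME (· ^ c))` takes exactly TWO values — `∅` at `c = 0` and (under `H1`)
`BPP` at every `c ≥ 1` — and carries no exponent information whatsoever:

* the `∃ c` of `CompactnessPrinciple` can only be witnessed by `c ≥ 1` as soon as `QuadQ` has one
  element (`exponent_pos_of_subset_bp_DTIME_pow`), i.e. the typed crux reads "`BQP ⊆ BPP → QuadQ ⊆ BPP`";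
* rung `c = 0` of the sibling `LanguageLadder` holds iff `QuadQ ≠ ∅` (`exists_not_mem_bp_DTIME_pow_zero_iff`),
  and every rung `c ≥ 1` reads "`QuadQ ⊄ BPP`" (the summit restricted to `QuadQ`);
* stub `stub_preimage` of the picked line `universal-clock-padding` is VACUOUS at `d = 0`
  (`DTIME (fun n => n ^ 0) = ∅`), so only `d ≥ 1` carries content there.

The engine is the tree's halting rule made a theorem: a halting `TM2` run must pop its whole input
(`haltList` carries nothing but the output word) and pops at most `machinePopBound` symbols per step
(`TM2Comp.length_step_ge`, PPST-Blocks), whence the **input-consumption bound**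
`|l| ≤ |l'| + Q · m` (`length_input_le_of_outputsWithin`, the twin of the tree's output bound
`OutputsWithin.length_le`) and `TimeClass (fun _ => c) = ∅` (`timeClass_const_eq_empty`) — the
"sublinear classes are empty" convention of `TimeBounds.lean` / `Classes.lean`, so far only a docstring.
Sorry-free; no definitions.
-/

set_option linter.dupNamespace false

namespace Summit.QuantumAdvantage.QuantumAdvantage.Theorems.CompactnessPrinciple.Negative

open Turing Function
open Literature.Computability.Complexity Literature.Computability.Cryptography
open Literature.Computability.Complexity.TM2Comp

/-- Induction along an `n`-step run for a quantity that SHRINKS by at most `D` per step (twin of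
`TM2Comp.iterate_bind_le`). [folklore] -/
theorem iterate_bind_ge {σ : Type*} (f : σ → Option σ) (φ : σ → ℕ) (D : ℕ)
    (H : ∀ c d, f c = some d → φ c ≤ φ d + D) (n : ℕ) :
    ∀ c d, (flip bind f)^[n] (some c) = some d → φ c ≤ φ d + D * n := by
  induction n with
  | zero =>
    intro c d h
    simp only [iterate_zero, id_eq, Option.some.injEq] at h
    simp [h]
  | succ n ih =>
    intro c d h
    rw [iterate_bind_succ] at h
    cases hfc : f c with
    | none => rw [hfc, iterate_bind_none] at h; cases h
    | some c' =>
      rw [hfc] at h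
      have h1 := H c c' hfc
      have h2 := ih c' d h
      rw [Nat.mul_succ]
      omega

/-- **Input-consumption bound.** If `M` maps `l` to `l'` within `m` steps then
`|l| ≤ |l'| + Q · m`, `Q = machinePopBound M.tm`: the halting configuration `haltList` carries only
the output word (so the input stack ends with at most `|l'|` symbols) and one step pops at most `Q`
symbols from any stack (`TM2Comp.length_step_ge`). Twin of the output bound
`Turing.TM2ComputableAux.OutputsWithin.length_le`. [folklore] -/
theorem length_input_le_of_outputsWithin {Γ₀ Γ₁ : Type} (M : TM2ComputableAux Γ₀ Γ₁)
    {l : List Γ₀} {l' : List Γ₁} {m : ℕ} (h : M.OutputsWithin l l' m) :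
    l.length ≤ l'.length + machinePopBound M.tm * m := by
  obtain ⟨⟨⟨n, hn⟩, hnm⟩⟩ := h
  have H := iterate_bind_ge M.tm.step (fun c => (c.stk M.tm.k₀).length) (machinePopBound M.tm)
    (fun c d hcd => length_step_ge M.tm c d hcd M.tm.k₀) n _ _ hn
  rw [haltList_eq, initList_eq] at H
  simp only [update_self, List.length_map] at H
  have H' := length_update_bot_le (Γ := M.tm.Γ) M.tm.k₁ M.tm.k₀ (l'.map M.outputAlphabet.symm)
  rw [List.length_map] at H'
  change n ≤ m at hnm
  calc l.length ≤ _ + machinePopBound M.tm * n := H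
    _ ≤ l'.length + machinePopBound M.tm * m :=
        Nat.add_le_add H' (Nat.mul_le_mul_left _ hnm)

/-- **Constant-time classes are empty**: no machine decides a language within a constant number `c`
of steps on every input, since the input `1^{Q c + 2}` cannot be consumed (the verdict `encodeBool b`
has length `1`). The tree's halting-rule convention ("`TimeClass t = ∅` for sublinear `t`",
`TimeBounds.lean`) as a theorem in the constant case. [folklore] -/
theorem timeClass_const_eq_empty (c : ℕ) : TimeClass (fun _ => c) = ∅ := by
  ext L
  simp only [Set.mem_empty_iff_false, iff_false]
  rintro ⟨M, hM⟩
  have h := length_input_le_of_outputsWithin M (hM (List.replicate (machinePopBound M.tm * c + 2) true))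
  simp [Computability.encodeBool] at h
  omega

/-- `DTIME` of a bounded time function is empty. [folklore] -/
theorem DTIME_eq_empty_of_le {t : ℕ → ℕ} {B : ℕ} (ht : ∀ n, t n ≤ B) : DTIME t = ∅ := by
  refine Set.eq_empty_of_subset_empty fun L hL => ?_
  obtain ⟨c, hc⟩ := DTIME_mono ht hL
  have : TimeClass (fun _ : ℕ => c * B + c) = ∅ := timeClass_const_eq_empty _
  rw [this] at hc
  exact hc

/-- **The slice `c = 0` of the deterministic family is empty**: `DTIME (fun n => n ^ 0) = DTIME 1 = ∅`.
In particular stub `stub_preimage` of line `universal-clock-padding` is vacuous at `d = 0`. [folklore] -/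
theorem DTIME_pow_zero_eq_empty : DTIME (fun n => n ^ 0) = ∅ :=
  DTIME_eq_empty_of_le (B := 1) fun n => by simp

/-- The bounded-error operator of the empty class is empty (`bp C` asks for an inner language in
`C`). [folklore] -/
theorem bp_empty : bp (∅ : Set (Language Bool)) = ∅ := by
  ext L; simp [bp]

/-- The `O(t)`-coin operator of the empty class is empty. [folklore] -/
theorem bpTime_empty (t : ℕ → ℕ) : bpTime t (∅ : Set (Language Bool)) = ∅ := by
  ext L; simp [bpTime]

/-- **The slice `c = 0` of the crux's class family is empty**: `bp (DTIME (fun n => n ^ 0)) = ∅`.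
With `Disproof.bp_DTIME_pow_eq_BPP` (every slice `c ≥ 1` is `BPP` under `H1`) the typed family
`c ↦ bp (DTIME (· ^ c))` takes exactly the two values `∅`, `BPP`. [folklore] -/
theorem bp_DTIME_pow_zero_eq_empty : bp (DTIME fun n => n ^ 0) = ∅ := by
  rw [DTIME_pow_zero_eq_empty, bp_empty]

/-- A class lies in the slice `c = 0` iff it is empty (reading for the `∃ c` of the crux: `c = 0`
witnesses `QuadQ ⊆ bp (DTIME n^c)` iff `QuadQ = ∅`). [folklore] -/
theorem subset_bp_DTIME_pow_zero_iff (Q : Set (Language Bool)) :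
    Q ⊆ bp (DTIME fun n => n ^ 0) ↔ Q = ∅ := by
  rw [bp_DTIME_pow_zero_eq_empty, Set.subset_empty_iff]

/-- Rung `c = 0` of a ladder over the typed family holds iff the class is nonempty (reading for the
sibling crux `LanguageLadder` at `c = 0`: it says exactly `QuadQ ≠ ∅`). [folklore] -/
theorem exists_not_mem_bp_DTIME_pow_zero_iff (Q : Set (Language Bool)) :
    (∃ L ∈ Q, L ∉ bp (DTIME fun n => n ^ 0)) ↔ Q.Nonempty := by
  rw [bp_DTIME_pow_zero_eq_empty]
  exact ⟨fun ⟨L, hL, _⟩ => ⟨L, hL⟩, fun ⟨L, hL⟩ => ⟨L, hL, fun h => h⟩⟩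

/-- **Tightness of the exponent in the typed crux.** For the route's class `QuadQ` (the verbatim
comprehension of `CompactnessLift.CompactnessPrinciple`): once `QuadQ` has an element, any exponent `c`
with `QuadQ ⊆ bp (DTIME (fun n => n ^ c))` — i.e. any witness of the crux's conclusion — satisfies
`1 ≤ c`. (And `c = 1` does witness it under `BQP ⊆ BPP` and `H1`, `Disproof.compactnessPrinciple_of_H1`:
the bound `1` is attained.) [folklore] -/
theorem exponent_pos_of_subset_bp_DTIME_pow
    (hne : Set.Nonempty {L : Language Bool | ∃ F : QCircuitFamily cliffordT, F.IsOracleFree ∧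
      (∃ C : ℕ, TimeComputable _root_.Computability.unaryEncodeNat (QCircuit.sigmaEncode (G := cliffordT))
        (fun n => (⟨n, F.ancillas n, F.circ n⟩ : Σ n m : ℕ, QCircuit cliffordT (n + m)))
        (fun n => C * n ^ 2 + C)) ∧
      ∀ x, (x ∈ L → 2 / 3 ≤ F.acceptProbOn 0 x) ∧ (x ∉ L → F.acceptProbOn 0 x ≤ 1 / 3)})
    {c : ℕ}
    (hc : {L : Language Bool | ∃ F : QCircuitFamily cliffordT, F.IsOracleFree ∧
      (∃ C : ℕ, TimeComputable _root_.Computability.unaryEncodeNat (QCircuit.sigmaEncode (G := cliffordT))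
        (fun n => (⟨n, F.ancillas n, F.circ n⟩ : Σ n m : ℕ, QCircuit cliffordT (n + m)))
        (fun n => C * n ^ 2 + C)) ∧
      ∀ x, (x ∈ L → 2 / 3 ≤ F.acceptProbOn 0 x) ∧ (x ∉ L → F.acceptProbOn 0 x ≤ 1 / 3)} ⊆
      bp (DTIME fun n => n ^ c)) :
    1 ≤ c := by
  rcases Nat.eq_zero_or_pos c with rfl | h
  · exact absurd ((subset_bp_DTIME_pow_zero_iff _).1 hc) hne.ne_empty
  · exact h

end Summit.QuantumAdvantage.QuantumAdvantage.Theorems.CompactnessPrinciple.Negative
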